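import Mathlib
import Literature.Analysis.FluidPDE.HardSphereCollisionRecord
import Literature.MathematicalPhysics.KineticTheory.HardSphereEuler
import HarnessLib

/-!
# `OneFlightGossipEngine.OneFlightLayeredChaos` — the thin-box brick: the cell-boundary layer
(crux stmt-AtomisticToContinuum-14535, line `Sketch`, lead cycle c3, wave 3; registered stubs
`volume_cellBoundaryLayer_le`, `coarseCell_eq_of_not_mem_cellBoundaryLayer`)

In the crux the positions are known through the cells `Torus.coarseCell r` of side `r = ℓ` (one mean
free path) of the flat torus `T³`, and the impact geometry moves a particle by at most `2ε`; the
event "the cell of the particle changes under such a move" is the THIN-BOX event. This file supplies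
the two facts the first-rung input `OLC.FirstFlightVelInput` and the disc stubs' (R3) consume:

* `OLC.cellBoundaryLayer r η ⊆ T³` — the points one of whose torus coordinates is within `η` (on the
  circle `ℝ/ℤ`) of the CELL GRID `OLC.cellGrid r = {m r : |m| ≤ ⌊1/(2r)⌋} ∪ {1/2}` of the symmetric
  fundamental domain `(-1/2, 1/2]` in which `Torus.coarseCell r x = (⌊x̃_k / r⌋)_k` reads the
  coordinates (the seam `1/2 ≡ -1/2` is a face of the first and of the last cell);
* (A) SHIFT STABILITY `coarseCell_eq_of_not_mem_cellBoundaryLayer`: off the layer, a second point at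
  minimal-image distance `≤ η` (`Torus.euclidDist`) has the same cell (only `0 < r` is needed); the
  variants through the sup-distance of the coordinates and through a translate `x + proj δ`,
  `‖δ‖ ≤ η`, are `coarseCell_eq_of_norm_apply_sub_le` / `coarseCell_add_proj_eq_of_not_mem_cellBoundaryLayer`;
* (B) SMALL VOLUME `volume_cellBoundaryLayer_le`: `volume (cellBoundaryLayer r η) ≤ 12 η / r` for
  `0 < r ≤ 1` (three coordinates, at most `2⌊1/(2r)⌋ + 2 ≤ 2/r` grid values each, a slab of Haar
  measure `≤ 2η` about each: `AddCircle.volume_closedBall` and `measurePreserving_eval`).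

The layer is closed (`isClosed_cellBoundaryLayer`), hence measurable.
-/

open scoped ENNReal
open MeasureTheory Set Metric
open Literature.Analysis.FluidPDE Literature.MathematicalPhysics.KineticTheory

namespace Summit.AtomisticToContinuum.HydrodynamicLimit.Theorems.OLC

noncomputable section

/-! ## The cell grid of one coordinate and the cell-boundary layer -/

/-- The number of cell faces of the mesh `r` in each closed half of the symmetric fundamental domain
`(-1/2, 1/2]` of a torus coordinate, the face `0` excluded: `⌊1/(2r)⌋`. [folklore] -/
def cellGridRadius (r : ℝ) : ℕ := ⌊1 / (2 * r)⌋₊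

/-- The CELL GRID of one torus coordinate at mesh `r`: the face values `m r` (`m ∈ ℤ`,
`|m| ≤ ⌊1/(2r)⌋`, equivalently `|m r| ≤ 1/2`) of the cells `⌊x̃ / r⌋` of the symmetric representative
`x̃ ∈ (-1/2, 1/2]` (`Torus.reprSym`), together with the seam `1/2 ≡ -1/2` of the fundamental domain,
where the first and the last cell of the coordinate meet. [folklore] -/
def cellGrid (r : ℝ) : Finset ℝ :=
  insert (1 / 2) ((Finset.Icc (-(cellGridRadius r : ℤ)) (cellGridRadius r)).image
    fun m : ℤ => (m : ℝ) * r)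

/-- The CELL-BOUNDARY LAYER of width `η` of the mesh `r` on `T³` — the thin-box event of the crux
line ("a particle within `η` of a cell face"): the points of the torus one of whose coordinates is
within distance `η` (quotient distance of the circle `ℝ/ℤ`) of a value of the cell grid `cellGrid r`.
Off this set a displacement of minimal-image length `≤ η` does not change the cell
`Torus.coarseCell r` (`coarseCell_eq_of_not_mem_cellBoundaryLayer`), and its Haar probability is
`≤ 12 η / r` (`volume_cellBoundaryLayer_le`). [folklore] -/
def cellBoundaryLayer (r η : ℝ) : Set T3 :=
  {x | ∃ i : Fin 3, ∃ g ∈ cellGrid r, ‖x i - ((g : ℝ) : UnitAddCircle)‖ ≤ η}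

/-- Membership in the cell-boundary layer, unfolded. [folklore] -/
theorem mem_cellBoundaryLayer_iff {r η : ℝ} {x : T3} :
    x ∈ cellBoundaryLayer r η ↔ ∃ i : Fin 3, ∃ g ∈ cellGrid r, ‖x i - ((g : ℝ) : UnitAddCircle)‖ ≤ η :=
  Iff.rfl

/-- The seam `1/2` belongs to the cell grid. [folklore] -/
theorem one_half_mem_cellGrid (r : ℝ) : (1 / 2 : ℝ) ∈ cellGrid r :=
  Finset.mem_insert_self _ _

/-- The face values `m r`, `|m| ≤ ⌊1/(2r)⌋`, belong to the cell grid. [folklore] -/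
theorem int_mul_mem_cellGrid {r : ℝ} {m : ℤ} (h₁ : -(cellGridRadius r : ℤ) ≤ m)
    (h₂ : m ≤ cellGridRadius r) : (m : ℝ) * r ∈ cellGrid r :=
  Finset.mem_insert_of_mem (Finset.mem_image.2 ⟨m, Finset.mem_Icc.2 ⟨h₁, h₂⟩, rfl⟩)

/-- The cell-boundary layer is a finite union of coordinate slabs (preimages of closed balls of the
circle under the coordinate maps). [folklore] -/
theorem cellBoundaryLayer_eq_iUnion (r η : ℝ) :
    cellBoundaryLayer r η =
      ⋃ i : Fin 3, ⋃ g ∈ cellGrid r, (fun x : T3 => x i) ⁻¹' closedBall ((g : ℝ) : UnitAddCircle) η := by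
  ext x
  simp only [mem_cellBoundaryLayer_iff, mem_iUnion, mem_preimage, mem_closedBall, dist_eq_norm,
    exists_prop]

/-- The cell-boundary layer is closed. [folklore] -/
theorem isClosed_cellBoundaryLayer (r η : ℝ) : IsClosed (cellBoundaryLayer r η) := by
  rw [cellBoundaryLayer_eq_iUnion]
  refine isClosed_iUnion_of_finite fun i => ?_
  refine (cellGrid r).finite_toSet.isClosed_biUnion fun g _ => ?_
  exact isClosed_closedBall.preimage (continuous_apply i)

/-- The cell-boundary layer is measurable. [folklore] -/
theorem measurableSet_cellBoundaryLayer (r η : ℝ) : MeasurableSet (cellBoundaryLayer r η) :=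
  (isClosed_cellBoundaryLayer r η).measurableSet

/-! ## (B) The layer is small -/

/-- The cell grid has at most `2⌊1/(2r)⌋ + 2` values. [folklore] -/
theorem card_cellGrid_le (r : ℝ) : (cellGrid r).card ≤ 2 * cellGridRadius r + 2 := by
  unfold cellGrid
  calc (insert (1 / 2 : ℝ) ((Finset.Icc (-(cellGridRadius r : ℤ)) (cellGridRadius r)).image
          fun m : ℤ => (m : ℝ) * r)).card
      ≤ ((Finset.Icc (-(cellGridRadius r : ℤ)) (cellGridRadius r)).image
          fun m : ℤ => (m : ℝ) * r).card + 1 := Finset.card_insert_le _ _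
    _ ≤ (Finset.Icc (-(cellGridRadius r : ℤ)) (cellGridRadius r)).card + 1 := by
        gcongr
        exact Finset.card_image_le
    _ = 2 * cellGridRadius r + 2 := by
        rw [Int.card_Icc]
        omega

/-- For `0 < r ≤ 1` the cell grid has at most `2/r` values: `2⌊1/(2r)⌋ + 2 ≤ 2/r`. [folklore] -/
theorem two_mul_cellGridRadius_add_two_le {r : ℝ} (hr : 0 < r) (hr₁ : r ≤ 1) :
    2 * (cellGridRadius r : ℝ) + 2 ≤ 2 / r := by
  unfold cellGridRadius
  rcases le_or_gt r (1 / 2) with h | h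
  · have h1 : (⌊1 / (2 * r)⌋₊ : ℝ) ≤ 1 / (2 * r) := Nat.floor_le (by positivity)
    have h2 : (2 : ℝ) ≤ 1 / r := by
      rw [le_div_iff₀ hr]
      linarith
    have h3 : 2 * (1 / (2 * r)) + 1 / r = 2 / r := by
      field_simp
      ring
    linarith
  · have h1 : ⌊1 / (2 * r)⌋₊ = 0 :=
      Nat.floor_eq_zero.2 (by rw [div_lt_one (by positivity)]; linarith)
    rw [h1, Nat.cast_zero, mul_zero, zero_add, le_div_iff₀ hr]
    linarith

/-- A coordinate slab of width `2η` of `T³` has Haar probability at most `2η`. [folklore] -/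
theorem volume_preimage_apply_closedBall_le (i : Fin 3) (c : UnitAddCircle) (η : ℝ) :
    volume ((fun x : T3 => x i) ⁻¹' closedBall c η) ≤ ENNReal.ofReal (2 * η) := by
  have hev : MeasurePreserving (fun x : T3 => x i) volume volume :=
    measurePreserving_eval (fun _ : Fin 3 => (volume : Measure UnitAddCircle)) i
  rw [hev.measure_preimage measurableSet_closedBall.nullMeasurableSet, AddCircle.volume_closedBall]
  exact ENNReal.ofReal_le_ofReal (min_le_right _ _)

/-- **(B) The thin-box estimate.** For a mesh `0 < r ≤ 1` and any width `η`, the cell-boundary layer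
has Haar probability `volume (cellBoundaryLayer r η) ≤ 12 η / r` (three coordinates, `≤ 2/r` grid
values each, a slab of measure `≤ 2η` about each). [folklore] -/
theorem volume_cellBoundaryLayer_le : ∀ {r η : ℝ}, 0 < r → r ≤ 1 → MeasureTheory.volume (Summit.AtomisticToContinuum.HydrodynamicLimit.Theorems.OLC.cellBoundaryLayer r η) ≤ ENNReal.ofReal (12 * η / r) := by
  intro r η hr hr₁
  rw [cellBoundaryLayer_eq_iUnion]
  calc volume (⋃ i : Fin 3, ⋃ g ∈ cellGrid r,
          (fun x : T3 => x i) ⁻¹' closedBall ((g : ℝ) : UnitAddCircle) η)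
      ≤ ∑ i : Fin 3, volume (⋃ g ∈ cellGrid r,
          (fun x : T3 => x i) ⁻¹' closedBall ((g : ℝ) : UnitAddCircle) η) :=
        measure_iUnion_fintype_le _ _
    _ ≤ ∑ i : Fin 3, ∑ g ∈ cellGrid r,
          volume ((fun x : T3 => x i) ⁻¹' closedBall ((g : ℝ) : UnitAddCircle) η) := by
        gcongr with i
        exact measure_biUnion_finset_le _ _
    _ ≤ ∑ _i : Fin 3, ∑ _g ∈ cellGrid r, ENNReal.ofReal (2 * η) := by
        gcongr with i _ g _
        exact volume_preimage_apply_closedBall_le i _ η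
    _ = ((3 * (cellGrid r).card : ℕ) : ℝ≥0∞) * ENNReal.ofReal (2 * η) := by
        simp only [Finset.sum_const, Finset.card_univ, Fintype.card_fin, nsmul_eq_mul]
        push_cast
        ring
    _ ≤ ((3 * (2 * cellGridRadius r + 2) : ℕ) : ℝ≥0∞) * ENNReal.ofReal (2 * η) := by
        gcongr
        exact card_cellGrid_le r
    _ ≤ ENNReal.ofReal (12 * η / r) := by
        rcases le_or_gt 0 η with hη | hη
        · rw [← ENNReal.ofReal_natCast, ← ENNReal.ofReal_mul (by positivity)]
          refine ENNReal.ofReal_le_ofReal ?_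
          have h := two_mul_cellGridRadius_add_two_le hr hr₁
          have h12 : 3 * (2 / r) * (2 * η) = 12 * η / r := by
            field_simp
            ring
          calc ((3 * (2 * cellGridRadius r + 2) : ℕ) : ℝ) * (2 * η)
              = 3 * (2 * (cellGridRadius r : ℝ) + 2) * (2 * η) := by push_cast; ring
            _ ≤ 3 * (2 / r) * (2 * η) := by gcongr
            _ = 12 * η / r := h12
        · rw [ENNReal.ofReal_eq_zero.2 (by linarith : 2 * η ≤ 0), mul_zero]
          exact bot_le

/-! ## (A) Off the layer, small displacements do not change the cell -/

/-- One coordinate of the shift stability, on representatives: if `t` is `η`-inside `(-1/2, 1/2)`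
(far from the seam `±1/2`) and `η`-far from the faces `m r`, `|m| ≤ ⌊1/(2r)⌋`, then every `s` with
`|t - s| ≤ η` lies in the cell of `t`: `⌊s/r⌋ = ⌊t/r⌋`. [folklore] -/
theorem floor_div_eq_floor_div_of_far {r η t s : ℝ} (hr : 0 < r) (hts : |t - s| ≤ η)
    (hhi : t < 1 / 2 - η) (hlo : -(1 / 2) + η < t)
    (hgrid : ∀ m : ℤ, -(cellGridRadius r : ℤ) ≤ m → m ≤ cellGridRadius r → η < |t - m * r|) :
    ⌊s / r⌋ = ⌊t / r⌋ := by
  set k : ℤ := ⌊t / r⌋ with hk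
  set M : ℕ := cellGridRadius r with hM
  have hk₁ : (k : ℝ) * r ≤ t := by
    have h : (k : ℝ) ≤ t / r := Int.floor_le _
    rwa [le_div_iff₀ hr] at h
  have hk₂ : t < ((k : ℝ) + 1) * r := by
    have h : t / r < (k : ℝ) + 1 := Int.lt_floor_add_one _
    rwa [div_lt_iff₀ hr] at h
  have hts' := abs_le.1 hts
  have hMr : 1 / 2 < ((M : ℝ) + 1) * r := by
    have h : 1 / (2 * r) < (⌊1 / (2 * r)⌋₊ : ℝ) + 1 := Nat.lt_floor_add_one _
    rw [div_lt_iff₀ (by positivity)] at h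
    change 1 < ((M : ℝ) + 1) * (2 * r) at h
    linarith
  rw [Int.floor_eq_iff]
  constructor
  · -- lower face: `k r ≤ s`
    rw [le_div_iff₀ hr]
    by_cases hkM : -(M : ℤ) ≤ k
    · -- the lower face `k r` is a grid value (and `k ≤ M` since `k r ≤ t ≤ 1/2 < (M + 1) r`)
      have hkM' : k ≤ (M : ℤ) := by
        by_contra hlt
        have hle : (M : ℝ) + 1 ≤ (k : ℝ) := by exact_mod_cast (show (M : ℤ) + 1 ≤ k by omega)
        have := mul_le_mul_of_nonneg_right hle hr.le
        linarith
      have h := hgrid k hkM hkM'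
      rw [abs_of_nonneg (by linarith)] at h
      linarith
    · -- below the lowest grid face: the cell of `t` starts below `-1/2 < s`
      rw [not_le] at hkM
      have hle : (k : ℝ) + 1 ≤ -(M : ℝ) := by exact_mod_cast (show k + 1 ≤ -(M : ℤ) by omega)
      have := mul_le_mul_of_nonneg_right hle hr.le
      linarith
  · -- upper face: `s < (k + 1) r`
    rw [div_lt_iff₀ hr]
    by_cases hkM : k + 1 ≤ (M : ℤ)
    · -- the upper face `(k + 1) r` is a grid value (and `-M ≤ k + 1` since `(k+1) r > t > -1/2`)
      have hkM' : -(M : ℤ) ≤ k + 1 := by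
        by_contra hlt
        have hle : (k : ℝ) + 1 ≤ -((M : ℝ) + 1) := by
          exact_mod_cast (show k + 1 ≤ -((M : ℤ) + 1) by omega)
        have := mul_le_mul_of_nonneg_right hle hr.le
        linarith
      have h := hgrid (k + 1) hkM' hkM
      push_cast at h
      rw [abs_of_nonpos (by linarith)] at h
      linarith
    · -- above the highest grid face: the cell of `t` ends above `1/2 ≥ s`
      rw [not_le] at hkM
      have hle : (M : ℝ) + 1 ≤ (k : ℝ) + 1 := by exact_mod_cast (show (M : ℤ) + 1 ≤ k + 1 by omega)
      have := mul_le_mul_of_nonneg_right hle hr.le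
      linarith

/-- **(A) Shift stability, coordinatewise form.** If `x ∈ T³` is off the cell-boundary layer of
width `η` of the mesh `r > 0` and every coordinate of `y` is within `η` of that of `x` on the
circle (`‖x k - y k‖ ≤ η`, i.e. the sup-distance of the pi type), then `y` lies in the cell of `x`.
[folklore] -/
theorem coarseCell_eq_of_norm_apply_sub_le {r η : ℝ} {x y : T3} (hr : 0 < r)
    (hx : x ∉ cellBoundaryLayer r η) (hxy : ∀ k : Fin 3, ‖x k - y k‖ ≤ η) :
    Torus.coarseCell r y = Torus.coarseCell r x := by
  funext i
  change ⌊Torus.reprSym y i / r⌋ = ⌊Torus.reprSym x i / r⌋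
  set t : ℝ := Torus.reprSym x i with ht_def
  set s : ℝ := Torus.reprSym y i with hs_def
  have ht : t ∈ Ioc (-(1 / 2 : ℝ)) (1 / 2) := Torus.reprSym_apply_mem_Ioc x i
  have hs : s ∈ Ioc (-(1 / 2 : ℝ)) (1 / 2) := Torus.reprSym_apply_mem_Ioc y i
  have hxt : x i = ((t : ℝ) : UnitAddCircle) := (Torus.coe_reprSym_apply x i).symm
  have hys : y i = ((s : ℝ) : UnitAddCircle) := (Torus.coe_reprSym_apply y i).symm
  -- the quotient norm of the circle is at most the size of any representative
  have hnle : ∀ u : ℝ, ‖((u : ℝ) : UnitAddCircle)‖ ≤ |u| := fun u =>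
    QuotientAddGroup.norm_mk_le_norm.trans_eq (Real.norm_eq_abs u)
  -- off the layer: every grid value is `η`-far from `x i` on the circle
  have hfar : ∀ g ∈ cellGrid r, η < ‖((t - g : ℝ) : UnitAddCircle)‖ := by
    intro g hg
    by_contra hle
    exact hx ⟨i, g, hg, by rw [hxt, ← AddCircle.coe_sub]; exact not_lt.1 hle⟩
  -- the seam: `t` is `η`-inside `(-1/2, 1/2)`
  have h₁ := hfar _ (one_half_mem_cellGrid r)
  have hhi : t < 1 / 2 - η := by
    have h := h₁.trans_le (hnle _)
    rw [abs_sub_comm, abs_of_nonneg (by linarith [ht.2])] at h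
    linarith
  have hlo : -(1 / 2) + η < t := by
    have h₂ : ((t - 1 / 2 : ℝ) : UnitAddCircle) = ((t + 1 / 2 : ℝ) : UnitAddCircle) := by
      rw [← AddCircle.coe_add_period 1 (t - 1 / 2)]
      congr 1
      ring
    have h := h₁
    rw [h₂] at h
    have h' := h.trans_le (hnle _)
    rw [abs_of_pos (by linarith [ht.1])] at h'
    linarith
  -- hence the representatives themselves are `η`-close
  have hts : |t - s| ≤ η := by
    have h := hxy i
    rw [hxt, hys, ← AddCircle.coe_sub, UnitAddCircle.norm_eq] at h
    have h' := abs_le.1 h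
    have hn : round (t - s) = 0 := by
      have hlt : ((round (t - s) : ℤ) : ℝ) < 1 := by linarith [hs.1, h'.1]
      have hgt : (-1 : ℝ) < ((round (t - s) : ℤ) : ℝ) := by linarith [hs.2, h'.2]
      have hlt' : round (t - s) < 1 := by exact_mod_cast hlt
      have hgt' : -1 < round (t - s) := by exact_mod_cast hgt
      omega
    rw [hn, Int.cast_zero, sub_zero] at h
    exact h
  -- and the faces are `η`-far from `t`
  have hgrid : ∀ m : ℤ, -(cellGridRadius r : ℤ) ≤ m → m ≤ cellGridRadius r → η < |t - m * r| :=
    fun m hm₁ hm₂ => (hfar _ (int_mul_mem_cellGrid hm₁ hm₂)).trans_le (hnle _)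
  exact floor_div_eq_floor_div_of_far hr hts hhi hlo hgrid

/-- **(A) Shift stability.** If `x ∈ T³` is off the cell-boundary layer of width `η` of the mesh
`r > 0`, every point `y` at minimal-image distance `Torus.euclidDist x y ≤ η` lies in the cell of `x`:
`Torus.coarseCell r y = Torus.coarseCell r x`. [folklore] -/
theorem coarseCell_eq_of_not_mem_cellBoundaryLayer : ∀ {r η : ℝ} {x y : Literature.MathematicalPhysics.KineticTheory.T3}, 0 < r → x ∉ Summit.AtomisticToContinuum.HydrodynamicLimit.Theorems.OLC.cellBoundaryLayer r η → Literature.Analysis.FluidPDE.Torus.euclidDist x y ≤ η → Literature.Analysis.FluidPDE.Torus.coarseCell r y = Literature.Analysis.FluidPDE.Torus.coarseCell r x := by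
  intro r η x y hr hx hxy
  refine coarseCell_eq_of_norm_apply_sub_le hr hx fun k => ?_
  calc ‖x k - y k‖ = |Torus.reprSym (x - y) k| := by rw [Torus.abs_reprSym_apply, Pi.sub_apply]
    _ ≤ ‖Torus.reprSym (x - y)‖ := Torus.abs_reprSym_apply_le_norm _ k
    _ ≤ η := hxy

/-- **(A) Shift stability, translate form.** If `x ∈ T³` is off the cell-boundary layer of width
`η` of the mesh `r > 0` and `‖δ‖ ≤ η`, the translate `x + proj δ` lies in the cell of `x`. [folklore] -/
theorem coarseCell_add_proj_eq_of_not_mem_cellBoundaryLayer {r η : ℝ} {x : T3} {δ : V3} (hr : 0 < r)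
    (hx : x ∉ cellBoundaryLayer r η) (hδ : ‖δ‖ ≤ η) :
    Torus.coarseCell r (x + Literature.Analysis.FunctionSpaces.Torus.proj δ) = Torus.coarseCell r x := by
  refine coarseCell_eq_of_norm_apply_sub_le hr hx fun k => ?_
  have h : x k - (x + Literature.Analysis.FunctionSpaces.Torus.proj δ) k = ((-δ k : ℝ) : UnitAddCircle) := by
    rw [Pi.add_apply, Literature.Analysis.FunctionSpaces.Torus.proj_apply, AddCircle.coe_neg]
    abel
  rw [h]
  calc ‖((-δ k : ℝ) : UnitAddCircle)‖ ≤ |-δ k| :=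
        QuotientAddGroup.norm_mk_le_norm.trans_eq (Real.norm_eq_abs _)
    _ = |δ k| := abs_neg _
    _ ≤ ‖δ‖ := by simpa using PiLp.norm_apply_le δ k
    _ ≤ η := hδ

end

end Summit.AtomisticToContinuum.HydrodynamicLimit.Theorems.OLC
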